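import Summits.QuantumFields.YangMills.Theses.OnsetTautology
import Summits.QuantumFields.YangMills.Theses.SquareRootCeilings
import HarnessLib

/-!
# Currency module of LINES «MirrorCalibration» / «AtomicEngine» on crux ⟨stmt-QuantumFields-28169⟩
# `OnsetTautology.AtomicCalibrationR` (planner ym-idea-11 g15; critic idea-crit-9 #86 price P2 «one shared currency module»)

This file is the §0 / §1 / §1b block of the REGISTERED skeleton `ideators/ym-idea-11/g15/mirror-calibration.lean`
(sha 2a022763 / rev 2 2affbaeb), CHARACTER-FOR-CHARACTER and in the SAME namespace
`Summit.QuantumFields.YangMills.Cruxes.AtomicCalibrationR.MirrorCalibration`, so that every stub landing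
(E1 `stub_atomCeiling`, E2 `stub_offDiagonalWhitney`, E3 `stub_smearedAtomicBound`, B6 `stub_mirrorCalibration`,
B7 `stub_smearedIVData`) and both skeletons import ONE set of constants:

* §0 the route's atom currency `atomWt`, `atomWr`, `rpSquare`, `onsetSet`, `reflSite`, `IsAdmissibleProfile`
  (character-for-character the `let`s of items 28205 / 28128 / 23902);
* §1 the obligation Props `AtomCeilings` (E1, rev 2), `WhitneyPkg` (E2), `SmearedMomentBound` (E3 → E4);
* §1b the line's two new interfaces `MirrorCalibratedUnit` (B6) and `SmearedIVInput` / `SmearedIVData` (B7).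

Author of the definitions: planner ym-idea-11 g15 (landed unchanged by the LEAD seat ym-line-sfw-p2 g74 as a
landing service).  Definitions only — nothing is proved here.  HONEST LABEL: no crux, rung, leaf or summit statement
is proved by this file; the Yang–Mills mass gap is NOT proved.
-/

set_option autoImplicit false

noncomputable section

open scoped BigOperators
open MeasureTheory Filter Topology
open Literature.MathematicalPhysics.QuantumFieldTheory Literature.MathematicalPhysics.QuantumLattice
open Literature.MathematicalPhysics.AQFT (IsOffDiagonal)
open Summit.QuantumFields.YangMills.Theorems.InfiniteVolume (stateMomentStr)
open Summit.QuantumFields.YangMills.Theorems.InfVolRP (centreOffset)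
open Summit.QuantumFields.YangMills.Theses.OnsetTautology
  (AtomicSynthesis AtomicSqrtDominationR ComparableFloors OnsetContraction AtomicCalibrationR)

open Summit.QuantumFields.YangMills.Cruxes.OSLegsFromFemtoAndGap.DlrCollarTransfer (LowerBounds)

namespace Summit.QuantumFields.YangMills.Cruxes.AtomicCalibrationR.MirrorCalibration

/-! ## §0 The route's atom currency, named (character-for-character the `let`s of items 28205 / 28128 / 23902) -/

/-- Weight of the plaquette `p = (orientation, site)` in the single-orientation-set `b`-atom of scale `s` and offset `y`
(the route's `wt Q s y p`). -/
def atomWt (b : SchwartzMap (EuclideanSpace ℝ (Fin 4)) ℝ) (Q : Finset (Fin 4 × Fin 4)) (s : ℝ)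
    (y : EuclideanSpace ℝ (Fin 4)) (p : (Fin 4 × Fin 4) × (Fin 4 → ℤ)) : ℝ :=
  if p.1 ∈ Q ∧ p.1.1 < p.1.2 then b (s • (siteToE p.2 + centreOffset p.1) - y) else 0

/-- Weight of `p` in the TIME-REFLECTED atom (the route's `wr Q s y p`). -/
def atomWr (b : SchwartzMap (EuclideanSpace ℝ (Fin 4)) ℝ) (Q : Finset (Fin 4 × Fin 4)) (s : ℝ)
    (y : EuclideanSpace ℝ (Fin 4)) (p : (Fin 4 × Fin 4) × (Fin 4 → ℤ)) : ℝ :=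
  if p.1 ∈ Q ∧ p.1.1 < p.1.2 then b (timeReflection 4 (s • (siteToE p.2 + centreOffset p.1)) - y) else 0

variable {G : Type} [Group G] [TopologicalSpace G] [IsTopologicalGroup G] [CompactSpace G]
  [MeasurableSpace G] [BorelSpace G]

/-- The reflection-positivity square of the atom `(Q, s, y)` in the state `μ` (the route's `rpSq Q s y`). -/
def rpSquare (r : LatticeRep G) (μ : Measure (LGConfig 4 G)) (b : SchwartzMap (EuclideanSpace ℝ (Fin 4)) ℝ)
    (Q : Finset (Fin 4 × Fin 4)) (s : ℝ) (y : EuclideanSpace ℝ (Fin 4)) : ℝ :=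
  ∑' pp : ((Fin 4 × Fin 4) × (Fin 4 → ℤ)) × ((Fin 4 × Fin 4) × (Fin 4 → ℤ)),
    atomWr b Q s y pp.1 * atomWt b Q s y pp.2 * stateMomentStr G r μ 2 ![pp.1.1, pp.2.1] ![pp.1.2, pp.2.2]

/-- The onset of level `ε` of the profile `b` in the state `μ` (the route's `onset`): the scales `s > 0` at which some
single-orientation sub-cell-offset `b`-atom has reflection-positivity square `≥ ε`. -/
def onsetSet (r : LatticeRep G) (μ : Measure (LGConfig 4 G)) (b : SchwartzMap (EuclideanSpace ℝ (Fin 4)) ℝ)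
    (ε : ℝ) : Set ℝ :=
  {s : ℝ | 0 < s ∧ ∃ (q : Fin 4 × Fin 4) (y : EuclideanSpace ℝ (Fin 4)),
    (∀ i, 0 ≤ y i ∧ y i ≤ s) ∧ ε ≤ rpSquare r μ b {q} s y}

/-- The base site of the plaquette `p` reflected in the lattice hyperplane `x_k = c` (character-for-character the
reflected site of item 28168 `AtomicSqrtDominationR`). -/
def reflSite (k : Fin 4) (c : ℤ) (p : (Fin 4 × Fin 4) × (Fin 4 → ℤ)) : Fin 4 → ℤ :=
  fun l => if l = k then 2 * c - p.2 l - (if p.1.1 = k ∨ p.1.2 = k then 1 else 0) else p.2 l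

/-- ADMISSIBLE PROFILE: the five clauses of the route's `AdmissibleAtomProfile` (23903, proved) read as hypotheses on a
given `b` — compact support in positive time, non-zero mean, invariance under coordinate permutations, time symmetry. -/
def IsAdmissibleProfile (b : SchwartzMap (EuclideanSpace ℝ (Fin 4)) ℝ) : Prop :=
  HasCompactSupport b ∧ tsupport b ⊆ {u : EuclideanSpace ℝ (Fin 4) | 0 < u 0} ∧ (∫ u, b u) ≠ 0 ∧
    (∀ (π : Equiv.Perm (Fin 4)) (u : EuclideanSpace ℝ (Fin 4)), b (WithLp.toLp 2 fun i => u (π i)) = b u) ∧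
    (∃ t : ℝ, ∀ u : EuclideanSpace ℝ (Fin 4), b (WithLp.toLp 2 fun i => if i = 0 then t - u i else u i) = b u)

/-! ## §1 The three obligation Props of the line -/

/-- **E1 currency — `AtomCeilings` (rev 2) — the onset tautology as a CEILING, in the two-body currency of 28168.**
In every odd-torus limit state `μ` at `β ≥ 0`, for an admissible profile `b` with support radius `t` (`b u ≠ 0 → ‖u‖ ≤ t`)
and a level `ε > 0` whose onset lies in `(0, A]`: every single-orientation `b`-atom of scale `s > A` (`s > 0`) lying on
one side of a lattice hyperplane `x_k = c` at LATTICE DISTANCE `≥ t/s + 2` from its finite carrier `S` (physical distance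
≥ one profile radius — the regime the onset set controls) has reflected two-body square `≤ ε` — for EVERY axis `k`,
EVERY integer plane `c` and EVERY offset `y` (not only time, `c = 0`, `y ∈ [0,s]⁴`).  REV 2 (self-correction, g15
09:00Z): rev 1 asked this at the bare 28168 gap `2`; by OS contraction (`OnsetContraction`: moving the atom AWAY from the
mirror does not increase the square) the RP square GROWS as the mirror approaches the atom, so mirrors adjacent to a
UV-fine atom are NOT dominated by the onset set (which sees mirrors at lattice distance `≈ δ_b/s`) — rev 1 was over-strong
(a β-uniform contact statement of wall class); E3 only ever needs mirrors midway between Whitney slots `Λρ_j` apart,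
i.e. this regime with `Λ ≥ 2 + 4t + 4/C₀`. -/
def AtomCeilings : Prop :=
  ∀ (G : Type) [Group G] [TopologicalSpace G] [IsTopologicalGroup G] [CompactSpace G],
    IsCompactSimpleLieGroup G → Nonempty (G ≃ₜ* Matrix.specialUnitaryGroup (Fin 2) ℂ) →
    letI : MeasurableSpace G := borel G
    haveI : BorelSpace G := ⟨rfl⟩
    ∀ (r : LatticeRep G) (b : SchwartzMap (EuclideanSpace ℝ (Fin 4)) ℝ) (ε β A : ℝ) (μ : Measure (LGConfig 4 G)),
      IsAdmissibleProfile b → 0 < ε → 0 ≤ β → μ ∈ oddTorusLimitPoints r β →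
      (∀ s ∈ onsetSet r μ b ε, s ≤ A) →
      ∀ (S : Finset ((Fin 4 × Fin 4) × (Fin 4 → ℤ))) (q : Fin 4 × Fin 4) (s t : ℝ) (y : EuclideanSpace ℝ (Fin 4))
        (k : Fin 4) (c : ℤ), q.1 < q.2 → 0 < s → A < s → (∀ u, b u ≠ 0 → ‖u‖ ≤ t) →
        (∀ p, atomWt b {q} s y p ≠ 0 → p ∈ S) →
        ((∀ p ∈ S, ((p.2 k : ℤ) : ℝ) + t / s + 2 ≤ (c : ℝ)) ∨ (∀ p ∈ S, (c : ℝ) + t / s + 2 ≤ ((p.2 k : ℤ) : ℝ))) →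
        ∑ p ∈ S, ∑ p' ∈ S, atomWt b {q} s y p * atomWt b {q} s y p' *
            stateMomentStr G r μ 2 ![p.1, p'.1] ![reflSite k c p, p'.2] ≤ ε

/-- **E2 currency — `WhitneyPkg` (off-diagonal Whitney synthesis; pure analysis).**  For every separation ratio
`Λ ≥ 1` and derivative budget `N'` there are `N, α, C, γ` with: every off-diagonal complex Schwartz `n`-point test
function is a pointwise-convergent sum `F = Σ_j κ_j G_j` (`‖κ_j‖ ≤ 1`) of REAL Schwartz pieces `G_j` supported in
products of closed balls `∏_l B̄(c_{jl}, ρ_j)` of one radius `0 < ρ_j ≤ 1/2` whose slots are pairwise `≥ Λρ_j` apart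
along some axis, with scale-invariant derivative bounds `‖D^m G_j‖_∞ ≤ M_j / ρ_j^m` (`m ≤ N'n`) and
`Σ_j M_j ≤ α Cⁿ (n!)^γ ‖F‖_{Nn}` (factorial losses are E0′-compatible). -/
def WhitneyPkg : Prop :=
  ∀ (Λ : ℝ) (N' : ℕ), 1 ≤ Λ → ∃ (N : ℕ) (α C γ : ℝ), 0 ≤ α ∧ 0 ≤ C ∧ 0 ≤ γ ∧ ∀ (n : ℕ), 1 ≤ n →
    ∀ F : SchwartzMap (Fin n → EuclideanSpace ℝ (Fin 4)) ℂ, IsOffDiagonal F →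
      ∃ (κ : ℕ → ℂ) (Gp : ℕ → SchwartzMap (Fin n → EuclideanSpace ℝ (Fin 4)) ℝ)
        (cp : ℕ → Fin n → EuclideanSpace ℝ (Fin 4)) (ρ M : ℕ → ℝ),
        (∀ j, ‖κ j‖ ≤ 1) ∧ (∀ j, 0 < ρ j ∧ ρ j ≤ 1 / 2) ∧
        (∀ j, tsupport (Gp j) ⊆ {z | ∀ l, ‖z l - cp j l‖ ≤ ρ j}) ∧
        (∀ j (l l' : Fin n), l ≠ l' → ∃ k : Fin 4, Λ * ρ j ≤ |cp j l k - cp j l' k|) ∧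
        (∀ j (m : ℕ), m ≤ N' * n → ∀ z, ‖iteratedFDeriv ℝ m (Gp j) z‖ ≤ M j / ρ j ^ m) ∧
        (∀ j, 0 ≤ M j) ∧ Summable M ∧
        ∑' j, M j ≤ α * C ^ n * (n.factorial : ℝ) ^ γ * schwartzNorm (N * n) F ∧
        ∀ z, HasSum (fun j => κ j * ((Gp j z : ℝ) : ℂ)) (F z)

/-- **E3 → E4 interface — `SmearedMomentBound` (the all-smeared E0′ input).**  For an admissible profile `b` and a
level `ε > 0` there are constants `c n ≤ α Cⁿ (n!)^γ`, an order `N` and a threshold `β₄` such that in every odd-torus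
limit state `μ` at `β ≥ β₄` and every unit `a ∈ (0, 1]` lying UV-ward of the whole onset of `(b, ε, μ)`, the
centre-smeared plane-string functional of order `n ≥ 2` at lattice spacing `a` is bounded on off-diagonal test
functions by `c n ‖F‖_{Nn}` — character-for-character the functional of the leaf's DATA clause. -/
def SmearedMomentBound : Prop :=
  ∀ (G : Type) [Group G] [TopologicalSpace G] [IsTopologicalGroup G] [CompactSpace G],
    IsCompactSimpleLieGroup G → Nonempty (G ≃ₜ* Matrix.specialUnitaryGroup (Fin 2) ℂ) →
    letI : MeasurableSpace G := borel G
    haveI : BorelSpace G := ⟨rfl⟩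
    ∀ (r : LatticeRep G) (b : SchwartzMap (EuclideanSpace ℝ (Fin 4)) ℝ) (ε : ℝ), IsAdmissibleProfile b → 0 < ε →
      ∃ (c : ℕ → ℝ) (N : ℕ) (α C γ β₄ : ℝ), (∀ n, 0 ≤ c n ∧ c n ≤ α * C ^ n * (n.factorial : ℝ) ^ γ) ∧
        ∀ β : ℝ, β₄ ≤ β → ∀ μ ∈ oddTorusLimitPoints r β, ∀ a : ℝ, 0 < a → a ≤ 1 →
          (∀ s ∈ onsetSet r μ b ε, s ≤ a) →
          ∀ (n : ℕ) (q : Fin n → Fin 4 × Fin 4), 2 ≤ n → (∀ i, (q i).1 < (q i).2) →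
            ∀ F : SchwartzMap (Fin n → EuclideanSpace ℝ (Fin 4)) ℂ, IsOffDiagonal F →
              ‖∑' x : Fin n → (Fin 4 → ℤ), ((stateMomentStr G r μ n q x : ℝ) : ℂ) *
                  F (fun l => a • siteToE (x l) +
                    (a / 2) • (EuclideanSpace.single (q l).1 (1 : ℝ) + EuclideanSpace.single (q l).2 (1 : ℝ)))‖ ≤
                c n * schwartzNorm (N * n) F

/-! ## §1b The two NEW interfaces of this line -/

/-- **MCU — the mirror-calibrated unit.**  For every SU(2)-class `G`: a lattice representation `r`, a unit
`a : ℝ → ℝ` (positive, `→ 0`, eventually `≤ 1`), an admissible atom profile `b` and a level `ε > 0` such that the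
floors `LowerBounds G r a` hold AT the unit and, from some `β₇` on, in every odd-torus limit state at `β` every
`b`-atom scale in the onset set of level `ε` lies below the unit (onset domination). -/
def MirrorCalibratedUnit : Prop :=
  ∀ (G : Type) [Group G] [TopologicalSpace G] [IsTopologicalGroup G] [CompactSpace G],
    IsCompactSimpleLieGroup G → Nonempty (G ≃ₜ* Matrix.specialUnitaryGroup (Fin 2) ℂ) →
    letI : MeasurableSpace G := borel G
    haveI : BorelSpace G := ⟨rfl⟩
    ∃ (r : LatticeRep G) (a : ℝ → ℝ) (b : SchwartzMap (EuclideanSpace ℝ (Fin 4)) ℝ) (ε : ℝ),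
      IsAdmissibleProfile b ∧ 0 < ε ∧ (∀ β, 0 < a β) ∧ Tendsto a atTop (nhds 0) ∧ LowerBounds G r a ∧
      ∃ β₇ : ℝ, ∀ β : ℝ, β₇ ≤ β → a β ≤ 1 ∧ ∀ μ ∈ oddTorusLimitPoints r β, ∀ s ∈ onsetSet r μ b ε, s ≤ a β

/-- **The smeared infinite-volume input package** (per `G`): a unit `a → 0` with the floors `LowerBounds G r a` and,
from some `β₈` on, in EVERY odd-torus limit state at `β`, uniform bounds `‖Σ' x, M_n(μ) F(a•x + a•o_q)‖ ≤ c n ‖F‖_{Nn}`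
on all OFF-DIAGONAL test functions, `c n ≤ α Cⁿ (n!)^γ` (the leaf's DATA functional, character for character). -/
def SmearedIVInput : Prop :=
  ∀ (G : Type) [Group G] [TopologicalSpace G] [IsTopologicalGroup G] [CompactSpace G],
    IsCompactSimpleLieGroup G → Nonempty (G ≃ₜ* Matrix.specialUnitaryGroup (Fin 2) ℂ) →
    letI : MeasurableSpace G := borel G
    haveI : BorelSpace G := ⟨rfl⟩
    ∃ (r : LatticeRep G) (a : ℝ → ℝ) (c : ℕ → ℝ) (N : ℕ) (α C γ β₈ : ℝ),
      (∀ β, 0 < a β) ∧ Tendsto a atTop (nhds 0) ∧ LowerBounds G r a ∧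
      (∀ n, 0 ≤ c n ∧ c n ≤ α * C ^ n * (n.factorial : ℝ) ^ γ) ∧
      ∀ β : ℝ, β₈ ≤ β → ∀ μ ∈ oddTorusLimitPoints r β,
        ∀ (n : ℕ) (q : Fin n → Fin 4 × Fin 4), 2 ≤ n → (∀ i, (q i).1 < (q i).2) →
          ∀ F : SchwartzMap (Fin n → EuclideanSpace ℝ (Fin 4)) ℂ, IsOffDiagonal F →
            ‖∑' x : Fin n → (Fin 4 → ℤ), ((stateMomentStr G r μ n q x : ℝ) : ℂ) *
                F (fun l => a β • siteToE (x l) +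
                  (a β / 2) • (EuclideanSpace.single (q l).1 (1 : ℝ) + EuclideanSpace.single (q l).2 (1 : ℝ)))‖ ≤
              c n * schwartzNorm (N * n) F

/-- **SIV — the floor-shape-agnostic smeared infinite-volume OS engine**: the smeared input package gives the leaf
(`IVData` with the pointwise `MomentBounds6`/collar hypothesis replaced by smeared bounds on ⁰𝒮; the compactness step
`InfiniteVolume.exists_subseq_clm_limit` is stated for bounds on a submodule, Hahn–Banach inside). -/
def SmearedIVData : Prop :=
  SmearedIVInput → Summit.QuantumFields.YangMills.Theses.InfiniteVolumeContinuum.HypercubicOSDataFromInfiniteVolume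

end Summit.QuantumFields.YangMills.Cruxes.AtomicCalibrationR.MirrorCalibration

end
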